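import Summits.Ventures.PercRepro.Night2NonFatStructure
import Summits.Ventures.PercRepro.Night2NonFatLine
import Summits.Ventures.PercRepro.Night2NonFatLevelOne
import Summits.Ventures.PercRepro.Night2LineLoad

/-!
# night-2: the LINE regime — every lossy non-fat basis pair has a basis line carrying all but `≤ 36` points of `W` (gen 38)

A lossy pair has `11/18 ≤ capS Q < L1 Q = Σ_{w active} r_w` with `r_w = 7/(6(m_w + 2)) ≤ 7/30` (`m_w = |G ∖ cl (Q ∖ w)| ≥ 3`) over
at most five active faces.  Greedily: some face has `r > 11/90` (else `Σ ≤ 5 · 11/90 = 11/18`), i.e. `m ≤ 7`; a second one has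
`r > 17/180` (else `Σ ≤ 7/30 + 4 · 17/180 = 11/18`), i.e. `m ≤ 10`; a third has `r > 13/270` (else `Σ ≤ 14/30 + 3 · 13/270 = 11/18`),
i.e. `m ≤ 22` (`exists_three_of_sum_gt`).  A point of `W` in the three hyperplanes `cl (Q ∖ c)`, `cl (Q ∖ d)`, `cl (Q ∖ e)` lies in
`cl (Q ∖ {c, d, e})` (`dead_mem_clF_of_three`, g37) hence in `cl {a, b}` for the two remaining basis points (`mem_clF_sdiff_coloops_of_mem_clF`);
each face `w` has at most `m_w − 1` holes in `W`.  **`exists_pair_card_sdiff_clF_le`**: `∃ a ≠ b ∈ Q′, |W ∖ cl {a, b}| ≤ 6 + 9 + 21 = 36`.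
Paper: proofs/NIGHT-2-g38.md §4.
-/

namespace PercRepro.Shadow

open PercRepro.ThmH PercRepro.PerFlat

variable {α : Type*} [DecidableEq α] {M : Matroid α} [M.Finite] {G : Finset α}

omit [DecidableEq α] in
/-- A sum of at most `n` terms each `≤ t` is `≤ n · t`. -/
theorem sum_le_card_mul_of_le {S : Finset α} (r : α → ℚ) {t : ℚ} (ht : 0 ≤ t) {n : ℕ} (hn : S.card ≤ n)
    (hr : ∀ w ∈ S, r w ≤ t) : ∑ w ∈ S, r w ≤ (n : ℚ) * t := by
  calc ∑ w ∈ S, r w ≤ ∑ _w ∈ S, t := Finset.sum_le_sum hr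
    _ = (S.card : ℚ) * t := by rw [Finset.sum_const, nsmul_eq_mul]
    _ ≤ (n : ℚ) * t := by
        apply mul_le_mul_of_nonneg_right _ ht
        exact_mod_cast hn

/-- **Three heavy faces**: from `Σ_{w ∈ A} r w > 11/18`, `|A| ≤ 5`, `r ≤ 7/30`: three distinct `c, d, e ∈ A` with
`r c > 11/90`, `r d > 17/180`, `r e > 13/270`. -/
theorem exists_three_of_sum_gt {A : Finset α} (r : α → ℚ) (hA : A.card ≤ 5) (hr : ∀ w ∈ A, r w ≤ 7 / 30)
    (hsum : 11 / 18 < ∑ w ∈ A, r w) :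
    ∃ c ∈ A, ∃ d ∈ A, ∃ e ∈ A, c ≠ d ∧ c ≠ e ∧ d ≠ e ∧
      11 / 90 < r c ∧ 17 / 180 < r d ∧ 13 / 270 < r e := by
  -- the first face
  have hc : ∃ c ∈ A, 11 / 90 < r c := by
    by_contra h
    push Not at h
    have := sum_le_card_mul_of_le r (by norm_num : (0 : ℚ) ≤ 11 / 90) hA h
    linarith
  obtain ⟨c, hcA, hrc⟩ := hc
  have hsum1 : 11 / 18 - 7 / 30 < ∑ w ∈ A.erase c, r w := by
    have := Finset.add_sum_erase A r hcA
    have := hr c hcA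
    linarith
  have hA1 : (A.erase c).card ≤ 4 := by
    rw [Finset.card_erase_of_mem hcA]
    omega
  -- the second face
  have hd : ∃ d ∈ A.erase c, 17 / 180 < r d := by
    by_contra h
    push Not at h
    have := sum_le_card_mul_of_le r (by norm_num : (0 : ℚ) ≤ 17 / 180) hA1 h
    linarith
  obtain ⟨d, hdA, hrd⟩ := hd
  have hsum2 : 11 / 18 - 7 / 30 - 7 / 30 < ∑ w ∈ (A.erase c).erase d, r w := by
    have := Finset.add_sum_erase (A.erase c) r hdA
    have := hr d (Finset.mem_of_mem_erase hdA)
    linarith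
  have hA2 : ((A.erase c).erase d).card ≤ 3 := by
    rw [Finset.card_erase_of_mem hdA]
    omega
  -- the third face
  have he : ∃ e ∈ (A.erase c).erase d, 13 / 270 < r e := by
    by_contra h
    push Not at h
    have := sum_le_card_mul_of_le r (by norm_num : (0 : ℚ) ≤ 13 / 270) hA2 h
    linarith
  obtain ⟨e, heA, hre⟩ := he
  refine ⟨c, hcA, d, Finset.mem_of_mem_erase hdA, e,
    Finset.mem_of_mem_erase (Finset.mem_of_mem_erase heA), ?_, ?_, ?_, hrc, hrd, hre⟩
  · exact fun h => (Finset.mem_erase.1 hdA).1 h.symm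
  · exact fun h => (Finset.mem_erase.1 (Finset.mem_of_mem_erase heA)).1 h.symm
  · exact fun h => (Finset.mem_erase.1 heA).1 h.symm

/-- An active face `w` of the basis pair with request `r_w > t` misses at most `7/(6t) − 2` points of `G`. -/
theorem card_sdiff_clF_erase_lt_of_req_gt (hG : G ∈ flatsQ M (5 + 1)) (hd : (gr M \ G).card = 2)
    {Q : Finset α} {w : α} (hok : faceOk M G Q w) {t : ℚ} (hr : t < req M 5 (Q.erase w)) :
    (((G \ clF M (Q.erase w)).card : ℚ) + 2) * t < 7 / 6 := by
  rw [req_eq_of_thin hG hok.1, hd] at hr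
  unfold phiQ at hr
  push_cast at hr
  have hpos : (0 : ℚ) < ((G \ clF M (Q.erase w)).card : ℚ) + 2 := by positivity
  rw [lt_div_iff₀ hpos] at hr
  linarith

/-- The holes of a face `w` in `W = G ∖ Q` number at most `|G ∖ cl (Q ∖ w)| − 1`. -/
theorem card_holes_le (hG : G ∈ flatsQ M (5 + 1)) (hd : (gr M \ G).card = 2) (hk : kColoops M G = 1)
    {B : Finset α} (hB : B ∈ thinMembers M 5 G) (hnP : ¬ bigP M G B) {z : α} (hz : z ∈ G \ clF M B)
    {w : α} (hw : w ∈ insert z B) :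
    ((G \ insert z B) \ clF M ((insert z B).erase w)).card + 1 ≤ (G \ clF M ((insert z B).erase w)).card := by
  have hQG : insert z B ⊆ G := Finset.insert_subset (Finset.mem_sdiff.1 hz).1 (subset_G_of_mem_thinMembers hB)
  have hwG : w ∈ G \ clF M ((insert z B).erase w) :=
    Finset.mem_sdiff.2 ⟨hQG hw, notMem_clF_erase_of_mem hG hd hk hB hnP hz hw⟩
  have hsub : (G \ insert z B) \ clF M ((insert z B).erase w) ⊆
      (G \ clF M ((insert z B).erase w)).erase w := by
    intro x hx
    rw [Finset.mem_sdiff, Finset.mem_sdiff] at hx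
    rw [Finset.mem_erase, Finset.mem_sdiff]
    exact ⟨fun h => hx.1.2 (h ▸ hw), hx.1.1, hx.2⟩
  have := Finset.card_le_card hsub
  rw [Finset.card_erase_of_mem hwG] at this
  have hpos : 0 < (G \ clF M ((insert z B).erase w)).card := Finset.card_pos.2 ⟨w, hwG⟩
  omega

/-- **Every lossy non-fat basis pair has two basis points whose line carries all but at most `36` points of `W`.** -/
theorem exists_pair_card_sdiff_clF_le (hG : G ∈ flatsQ M (5 + 1)) (hd : (gr M \ G).card = 2)
    (hk : kColoops M G = 1) (hnf : fatClosures M 5 G 2 = ∅) {B : Finset α}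
    (hB : B ∈ thinMembers M 5 G) (hnP : ¬ bigP M G B) {z : α} (hz : z ∈ G \ clF M B)
    (hl0 : loss M 5 G B z ≠ 0) :
    ∃ a ∈ insert z B \ coloops M G, ∃ b ∈ insert z B \ coloops M G, a ≠ b ∧
      ((G \ insert z B) \ clF M {a, b}).card ≤ 36 := by
  have hd' : (gr M \ G).card ≤ 5 := by omega
  have hQG : insert z B ⊆ G := Finset.insert_subset (Finset.mem_sdiff.1 hz).1 (subset_G_of_mem_thinMembers hB)
  have hKB : coloops M G ⊆ B := coloops_subset_of_mem_thinMembers hG hd' hB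
  obtain ⟨-, hQ'5⟩ := rkN_insert_sdiff_coloops_eq_five hG hd hk hB hnP hz
  -- the requests of the active faces sum to more than `11/18`
  have hcap := capS_ge_eleven_eighteenths_two_one hd hk hQG
  have hlt := capS_lt_L1_of_loss_ne_zero hl0
  rw [L1_eq_sum_req_faces hG hd] at hlt
  have hsum : 11 / 18 < ∑ w ∈ (insert z B \ coloops M G).filter (fun w => faceOk M G (insert z B) w),
      req M 5 ((insert z B).erase w) := by linarith
  have hAcard : ((insert z B \ coloops M G).filter (fun w => faceOk M G (insert z B) w)).card ≤ 5 := by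
    rw [← hQ'5]
    exact Finset.card_filter_le _ _
  have hok : ∀ w ∈ (insert z B \ coloops M G).filter (fun w => faceOk M G (insert z B) w),
      faceOk M G (insert z B) w := fun w hw => (Finset.mem_filter.1 hw).2
  have hr : ∀ w ∈ (insert z B \ coloops M G).filter (fun w => faceOk M G (insert z B) w),
      req M 5 ((insert z B).erase w) ≤ 7 / 30 := fun w hw => req_le_of_nonfat hG hd hnf (hok w hw).1
  obtain ⟨c, hcA, d, hdA, e, heA, hcd, hce, hde, hrc, hrd, hre⟩ :=
    exists_three_of_sum_gt (fun w => req M 5 ((insert z B).erase w)) hAcard hr hsum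
  -- the three faces miss few points
  have hmc := card_sdiff_clF_erase_lt_of_req_gt hG hd (hok c hcA) hrc
  have hmd := card_sdiff_clF_erase_lt_of_req_gt hG hd (hok d hdA) hrd
  have hme := card_sdiff_clF_erase_lt_of_req_gt hG hd (hok e heA) hre
  have hmc' : (G \ clF M ((insert z B).erase c)).card ≤ 7 := by
    by_contra h
    have h8 : (8 : ℚ) ≤ ((G \ clF M ((insert z B).erase c)).card : ℚ) := by exact_mod_cast (by omega : 8 ≤ _)
    linarith
  have hmd' : (G \ clF M ((insert z B).erase d)).card ≤ 10 := by
    by_contra h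
    have h11 : (11 : ℚ) ≤ ((G \ clF M ((insert z B).erase d)).card : ℚ) := by exact_mod_cast (by omega : 11 ≤ _)
    linarith
  have hme' : (G \ clF M ((insert z B).erase e)).card ≤ 22 := by
    by_contra h
    have h23 : (23 : ℚ) ≤ ((G \ clF M ((insert z B).erase e)).card : ℚ) := by exact_mod_cast (by omega : 23 ≤ _)
    linarith
  have hcQ' : c ∈ insert z B \ coloops M G := (Finset.mem_filter.1 hcA).1
  have hdQ' : d ∈ insert z B \ coloops M G := (Finset.mem_filter.1 hdA).1
  have heQ' : e ∈ insert z B \ coloops M G := (Finset.mem_filter.1 heA).1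
  have hhc := card_holes_le hG hd hk hB hnP hz (Finset.mem_sdiff.1 hcQ').1
  have hhd := card_holes_le hG hd hk hB hnP hz (Finset.mem_sdiff.1 hdQ').1
  have hhe := card_holes_le hG hd hk hB hnP hz (Finset.mem_sdiff.1 heQ').1
  -- the two remaining basis points
  have hCQ' : ({c, d, e} : Finset α) ⊆ insert z B \ coloops M G := by
    intro x hx
    rw [Finset.mem_insert, Finset.mem_insert, Finset.mem_singleton] at hx
    rcases hx with rfl | rfl | rfl
    · exact hcQ'
    · exact hdQ'
    · exact heQ'
  have hC3 : ({c, d, e} : Finset α).card = 3 := by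
    rw [Finset.card_insert_of_notMem, Finset.card_pair hde]
    rw [Finset.mem_insert, Finset.mem_singleton]
    push Not
    exact ⟨hcd, hce⟩
  have hrest : ((insert z B \ coloops M G) \ {c, d, e}).card = 2 := by
    rw [Finset.card_sdiff_of_subset hCQ', hQ'5, hC3]
  obtain ⟨a, b, hab, hab_eq⟩ := Finset.card_eq_two.1 hrest
  have haQ' : a ∈ insert z B \ coloops M G := by
    have : a ∈ (insert z B \ coloops M G) \ {c, d, e} := by
      rw [hab_eq]
      exact Finset.mem_insert_self _ _
    exact (Finset.mem_sdiff.1 this).1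
  have hbQ' : b ∈ insert z B \ coloops M G := by
    have : b ∈ (insert z B \ coloops M G) \ {c, d, e} := by
      rw [hab_eq]
      exact Finset.mem_insert_of_mem (Finset.mem_singleton_self _)
    exact (Finset.mem_sdiff.1 this).1
  refine ⟨a, haQ', b, hbQ', hab, ?_⟩
  -- a point of `W` off `cl {a, b}` is a hole of `c`, `d` or `e`
  have hcomm : (insert z B \ {c, d, e}) \ coloops M G = (insert z B \ coloops M G) \ {c, d, e} := by
    ext x
    simp only [Finset.mem_sdiff]
    constructor
    · rintro ⟨⟨h1, h2⟩, h3⟩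
      exact ⟨⟨h1, h3⟩, h2⟩
    · rintro ⟨⟨h1, h2⟩, h3⟩
      exact ⟨⟨h1, h3⟩, h2⟩
  have hcover : (G \ insert z B) \ clF M {a, b} ⊆
      ((G \ insert z B) \ clF M ((insert z B).erase c)) ∪
        (((G \ insert z B) \ clF M ((insert z B).erase d)) ∪
          ((G \ insert z B) \ clF M ((insert z B).erase e))) := by
    intro y hy
    rw [Finset.mem_sdiff] at hy
    obtain ⟨hyW, hyl⟩ := hy
    have hyG : y ∈ G := (Finset.mem_sdiff.1 hyW).1
    by_contra hnot
    simp only [Finset.mem_union, Finset.mem_sdiff, not_or, not_and, not_not] at hnot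
    obtain ⟨h1, h2, h3⟩ := hnot
    have hyW' := Finset.mem_sdiff.1 hyW
    have hyall : ∀ w ∈ ({c, d, e} : Finset α), y ∈ clF M ((insert z B).erase w) := by
      intro w hw
      rw [Finset.mem_insert, Finset.mem_insert, Finset.mem_singleton] at hw
      rcases hw with rfl | rfl | rfl
      · exact h1 hyW'
      · exact h2 hyW'
      · exact h3 hyW'
    have hy1 := dead_mem_clF_of_three hG hd hk hB hnP hz (hCQ'.trans Finset.sdiff_subset) hyG hyall
    have hyK : y ∈ G \ coloops M G := by
      rw [Finset.mem_sdiff]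
      exact ⟨hyG, fun h => (Finset.mem_sdiff.1 hyW).2 (Finset.mem_insert_of_mem (hKB h))⟩
    have hy2 := mem_clF_sdiff_coloops_of_mem_clF hG hk (Finset.sdiff_subset.trans hQG) hyK hy1
    rw [hcomm, hab_eq] at hy2
    exact hyl hy2
  have hcard := Finset.card_le_card hcover
  have hu1 := Finset.card_union_le ((G \ insert z B) \ clF M ((insert z B).erase c))
    (((G \ insert z B) \ clF M ((insert z B).erase d)) ∪ ((G \ insert z B) \ clF M ((insert z B).erase e)))
  have hu2 := Finset.card_union_le ((G \ insert z B) \ clF M ((insert z B).erase d))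
    ((G \ insert z B) \ clF M ((insert z B).erase e))
  omega

end PercRepro.Shadow
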